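import Mathlib
import HarnessLib

/-!
# WeilTypeLadder · compact orderings II: walls (necessity) and the unit budgets in `ℤ/m`

b2b cell `hweil` (packet `run/shared/lean/b2b/hodge-weil/`, report `b2b-hweil-pv3-g42/COMPACT-CRITERION.md`, prover 3
generation 42). PURE COMBINATORICS / arithmetic of `ZMod m`; no geometry, no named fact, no `decide`.

For a multiset `β` of non-zero residues mod `m` and a unit `u`, the `u`-BUDGET is `m·#{x ∈ β : x = u} + Σ_{x∈β} val(u⁻¹x)`
(`= m·(#u + W_{u⁻¹})`, `W_n = (1/m)Σ rep(n βᵢ) = D(n) + 1` the winding number of the packet). This file proves: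

* `count_one_add_walls_le_length` (ℕ-form) ⟹ `compactOrdering_budget_one_le` ⟹ `compactOrdering_budget_le` —
  **NECESSITY**: a compactly ordered zero-sum list has `u`-budget `≤ m(N+1)` for every unit `u` (scaled so that `u = 1`,
  the increasing walk of representatives must jump over `W - 1` multiples of `m`, each time with a letter `≠ 1`);
* the bookkeeping of part III: `sum_map_val_add_le`, `card_add_le_two_mul_count_of_tight` (LEMMA T1: a unit with budget
  `m(N+1)` has multiplicity `≥ (N+m)/2` — at most one such unit), `budget_le_of_not_majority`, `budget_merge_le`
  (merging `g, y ↦ g+y`), `budget_pair_le` (removing `g, -g`), and small casting lemmas.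

HONEST LABEL: bookkeeping; 0 rungs; nothing of Markman 2025 / Mostaed 2026 / Perry 2026 is used; no kit job.
-/

-- every declaration of this problem lives in `Summit.HodgeConjecture.HodgeConjecture.…` (summit = sub-problem)
set_option linter.dupNamespace false

namespace Summit.HodgeConjecture.HodgeConjecture.WeilTypeLadder

open Multiset

section Necessity

/-- **Walls (ℕ-form).** A list of step sizes in `[1, m-1]` whose proper prefix sums are never multiples of `m`:
the number of unit steps plus the number of multiples of `m` strictly below the total is at most the number of steps
(a unit step never jumps over a multiple of `m`; a step `< m` jumps over at most one). [folklore] -/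
theorem count_one_add_walls_le_length (m : ℕ) (v : List ℕ) (h1 : ∀ x ∈ v, 1 ≤ x) (hm : ∀ x ∈ v, x + 1 ≤ m)
    (hw : ∀ k, 0 < k → k < v.length → ¬ m ∣ (v.take k).sum) :
    v.count 1 + (v.sum - 1) / m ≤ v.length := by
  induction v using List.reverseRecOn with
  | nil => simp
  | append_singleton w x ih =>
    have h1w : ∀ y ∈ w, 1 ≤ y := fun y hy => h1 y (List.mem_append_left _ hy)
    have hmw : ∀ y ∈ w, y + 1 ≤ m := fun y hy => hm y (List.mem_append_left _ hy)
    have hww : ∀ k, 0 < k → k < w.length → ¬ m ∣ (w.take k).sum := by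
      intro k hk hkl
      have := hw k hk (by simp; omega)
      rwa [List.take_append_of_le_length (by omega)] at this
    have ih' := ih h1w hmw hww
    have hx1 : 1 ≤ x := h1 x (by simp)
    have hxm : x + 1 ≤ m := hm x (by simp)
    rw [List.count_append, List.sum_append, List.length_append, List.sum_singleton, List.length_singleton,
      List.count_singleton']
    -- the sum of `w` is not a multiple of `m` unless `w = []`
    have hdiv : w ≠ [] → ¬ m ∣ w.sum := by
      intro hne
      have hl : 0 < w.length := List.length_pos_iff.mpr hne
      have := hw w.length hl (by simp)
      rwa [List.take_append_of_le_length le_rfl, List.take_length] at this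
    by_cases hw0 : w = []
    · subst hw0
      simp only [List.count_nil, List.sum_nil, zero_add, List.length_nil]
      have : (x - 1) / m = 0 := Nat.div_eq_of_lt (by omega)
      split_ifs <;> omega
    · have hnd := hdiv hw0
      have hspos : 1 ≤ w.sum := by
        obtain ⟨y, hy⟩ := List.exists_mem_of_ne_nil w hw0
        exact le_trans (h1w y hy) (List.single_le_sum (fun _ _ => Nat.zero_le _) y hy)
      have hmpos : 0 < m := by omega
      -- key arithmetic: `(w.sum + x - 1) / m ≤ (w.sum - 1) / m + 1`, with equality to `(w.sum - 1)/m` when `x = 1`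
      by_cases hx : x = 1
      · subst hx
        simp only [if_true]
        have : (w.sum + 1 - 1) / m = (w.sum - 1) / m := by
          rw [Nat.add_sub_cancel]
          have hmod : w.sum % m ≠ 0 := fun h => hnd (Nat.dvd_of_mod_eq_zero h)
          have e1 := Nat.div_add_mod w.sum m
          have hr : 0 < w.sum % m := Nat.pos_of_ne_zero hmod
          have hrm : w.sum % m < m := Nat.mod_lt _ hmpos
          have e2 : w.sum - 1 = m * (w.sum / m) + (w.sum % m - 1) := by omega
          have e4 : (w.sum % m - 1) / m = 0 := Nat.div_eq_of_lt (by omega)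
          rw [e2, Nat.mul_add_div hmpos, e4, add_zero]
        omega
      · simp only [hx, if_false, add_zero]
        have : (w.sum + x - 1) / m ≤ (w.sum - 1) / m + 1 := by
          have e : w.sum + x - 1 ≤ (w.sum - 1) + m := by omega
          calc (w.sum + x - 1) / m ≤ ((w.sum - 1) + m) / m := Nat.div_le_div_right e
            _ = (w.sum - 1) / m + 1 := Nat.add_div_right _ hmpos
        omega

end Necessity

section ZModBookkeeping

variable {m : ℕ} [NeZero m]

/-- A non-zero residue forces `m ≥ 2`. [folklore] -/
theorem one_lt_of_ne_zero {a : ZMod m} (ha : a ≠ 0) : 1 < m := by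
  by_contra h
  have hm : m = 1 := by have := NeZero.ne m; omega
  subst hm
  exact ha (Subsingleton.elim a 0)

/-- The sum of the representatives of `c • (letters)` reduces mod `m` to `c · Σ letters`. [folklore] -/
theorem natCast_sum_map_val_mul (c : ZMod m) (β : Multiset (ZMod m)) :
    (((β.map fun x => (c * x).val).sum : ℕ) : ZMod m) = c * β.sum := by
  induction β using Multiset.induction_on with
  | empty => simp
  | cons a s ih => simp [ih, mul_add]

/-- `m` divides the sum of the representatives of `u⁻¹ • β` when `β` sums to `0`. [folklore] -/
theorem dvd_sum_map_val_mul (c : ZMod m) (β : Multiset (ZMod m)) (hs : β.sum = 0) :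
    m ∣ (β.map fun x => (c * x).val).sum := by
  rw [← ZMod.natCast_eq_zero_iff, natCast_sum_map_val_mul, hs, mul_zero]

/-- Counting through a map that identifies exactly one letter with the target. [folklore] -/
theorem count_map_eq_count {α β' : Type*} [DecidableEq α] [DecidableEq β'] (f : α → β') (l : List α) (a : α) (b : β')
    (h : ∀ x ∈ l, f x = b ↔ x = a) : (l.map f).count b = l.count a := by
  induction l with
  | nil => simp
  | cons x t ih =>
    have hx := h x (by simp)
    have ht : ∀ y ∈ t, f y = b ↔ y = a := fun y hy => h y (by simp [hy])
    rw [List.map_cons, List.count_cons, List.count_cons, ih ht]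
    by_cases hxa : x = a
    · have hfx : f x = b := hx.mpr hxa
      subst hxa
      simp [hfx]
    · have hfx : f x ≠ b := fun e => hxa (hx.mp e)
      simp [hxa, hfx]

/-- **The crude bound (LEMMA T1's inequality).** For a unit `u` and non-zero letters: `Σ val(u⁻¹x) + (m-1)·#u ≤
(m-1)·N + #u` (the `u`'s have representative `1`, everything else at most `m - 1`). [folklore] -/
theorem sum_map_val_add_le (u : ZMod m) (hu : IsUnit u) (β : Multiset (ZMod m)) (h0 : ∀ x ∈ β, x ≠ 0) :
    (β.map fun x => (u⁻¹ * x).val).sum + (m - 1) * β.count u ≤ (m - 1) * card β + β.count u := by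
  induction β using Multiset.induction_on with
  | empty => simp
  | cons a s ih =>
    have ha : a ≠ 0 := h0 a (mem_cons_self a s)
    have hm : 1 < m := one_lt_of_ne_zero ha
    have ih' := ih fun x hx => h0 x (mem_cons_of_mem hx)
    rw [map_cons, sum_cons, count_cons, card_cons]
    by_cases hua : u = a
    · subst hua
      haveI : Fact (1 < m) := ⟨hm⟩
      rw [ZMod.inv_mul_of_unit u hu, ZMod.val_one]
      simp only [if_true]
      nlinarith [ih']
    · simp only [hua, if_false, add_zero]
      have : (u⁻¹ * a).val ≤ m - 1 := by have := ZMod.val_lt (u⁻¹ * a); omega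
      nlinarith [ih']

/-- **LEMMA T1 (tight ⟹ majority).** If the `u`-budget `m·#u + Σ val(u⁻¹x)` reaches `m(N+1)`, then
`2·#u ≥ N + m`: a tight unit is a strict majority letter; in particular two distinct units are never both tight.
[folklore] -/
theorem card_add_le_two_mul_count_of_tight (u : ZMod m) (hu : IsUnit u) (β : Multiset (ZMod m))
    (h0 : ∀ x ∈ β, x ≠ 0) (ht : m * (card β + 1) ≤ m * β.count u + (β.map fun x => (u⁻¹ * x).val).sum) :
    card β + m ≤ 2 * β.count u := by
  have h := sum_map_val_add_le u hu β h0
  have hm : 1 ≤ m := Nat.one_le_iff_ne_zero.mpr (NeZero.ne m)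
  obtain ⟨m', rfl⟩ : ∃ m', m = m' + 1 := ⟨m - 1, by omega⟩
  simp only [Nat.add_sub_cancel] at h
  nlinarith [h, ht]

/-- **Slack below tightness.** If the `u`-budget is at most `m(N+1)` but `u` is not a majority letter
(`2·#u < N + m`... in fact we use `2·#u + 2 ≤ N + m`), then the budget is at most `m·N` (it is a multiple of `m`).
[folklore] -/
theorem budget_le_of_not_majority (u : ZMod m) (hu : IsUnit u) (β : Multiset (ZMod m)) (h0 : ∀ x ∈ β, x ≠ 0)
    (hs : β.sum = 0) (hc : m * β.count u + (β.map fun x => (u⁻¹ * x).val).sum ≤ m * (card β + 1))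
    (hnm : 2 * β.count u < card β + m) :
    m * β.count u + (β.map fun x => (u⁻¹ * x).val).sum ≤ m * card β := by
  obtain ⟨q, hq⟩ := dvd_sum_map_val_mul u⁻¹ β hs
  rw [hq] at hc ⊢
  have hmpos : 0 < m := Nat.pos_of_ne_zero (NeZero.ne m)
  have h1 : β.count u + q ≤ card β + 1 := by
    have : m * (β.count u + q) ≤ m * (card β + 1) := by rw [mul_add]; exact hc
    exact Nat.le_of_mul_le_mul_left this hmpos
  rcases Nat.lt_or_ge (β.count u + q) (card β + 1) with hlt | hge
  · calc m * β.count u + m * q = m * (β.count u + q) := by rw [mul_add]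
      _ ≤ m * card β := Nat.mul_le_mul_left _ (by omega)
  · exfalso
    have heq : β.count u + q = card β + 1 := le_antisymm h1 hge
    have ht : m * (card β + 1) ≤ m * β.count u + (β.map fun x => (u⁻¹ * x).val).sum := by
      rw [hq, ← mul_add, heq]
    have := card_add_le_two_mul_count_of_tight u hu β h0 ht
    omega

/-- **Merge bookkeeping.** Replacing two non-zero letters `g, y` by their sum `g + y` lowers the `u`-budget by at
least `m` when `g = u` and never raises it. [folklore] -/
theorem budget_merge_le (u : ZMod m) (hu : IsUnit u) (g y : ZMod m) (γ : Multiset (ZMod m)) (hg : g ≠ 0) (hy : y ≠ 0) :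
    m * ((g + y) ::ₘ γ).count u + (((g + y) ::ₘ γ).map fun x => (u⁻¹ * x).val).sum
      + m * (if u = g then 1 else 0)
      ≤ m * (g ::ₘ y ::ₘ γ).count u + ((g ::ₘ y ::ₘ γ).map fun x => (u⁻¹ * x).val).sum := by
  simp only [count_cons, map_cons, sum_cons, mul_add]
  have hm : 1 < m := one_lt_of_ne_zero hg
  haveI : Fact (1 < m) := ⟨hm⟩
  have hg' : (u⁻¹ * g).val ≠ 0 := by
    rw [Ne, ZMod.val_eq_zero]; intro h
    apply hg; have := congrArg (u * ·) h; simpa [← mul_assoc, ZMod.mul_inv_of_unit u hu] using this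
  have hy' : (u⁻¹ * y).val ≠ 0 := by
    rw [Ne, ZMod.val_eq_zero]; intro h
    apply hy; have := congrArg (u * ·) h; simpa [← mul_assoc, ZMod.mul_inv_of_unit u hu] using this
  by_cases hlt : (u⁻¹ * g).val + (u⁻¹ * y).val < m
  · have hval : (u⁻¹ * g + u⁻¹ * y).val = (u⁻¹ * g).val + (u⁻¹ * y).val := ZMod.val_add_of_lt hlt
    have hne : u ≠ g + y := by
      intro h
      have : (u⁻¹ * g + u⁻¹ * y).val = 1 := by rw [← mul_add, ← h, ZMod.inv_mul_of_unit u hu, ZMod.val_one]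
      omega
    simp only [hne, if_false, mul_zero, add_zero]
    split_ifs <;> omega
  · push Not at hlt
    have hval : (u⁻¹ * g).val + (u⁻¹ * y).val = (u⁻¹ * g + u⁻¹ * y).val + m := ZMod.val_add_val_of_le hlt
    split_ifs <;> omega

/-- **Pair bookkeeping.** Removing an inverse pair `g, -g` (`g ≠ 0`) lowers the `u`-budget by at least `m`, and by
at least `2m` when `g = u`. [folklore] -/
theorem budget_pair_le (u : ZMod m) (hu : IsUnit u) (g : ZMod m) (γ : Multiset (ZMod m)) (hg : g ≠ 0) :
    m * γ.count u + (γ.map fun x => (u⁻¹ * x).val).sum + m + m * (if u = g then 1 else 0)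
      ≤ m * (g ::ₘ (-g) ::ₘ γ).count u + ((g ::ₘ (-g) ::ₘ γ).map fun x => (u⁻¹ * x).val).sum := by
  simp only [count_cons, map_cons, sum_cons, mul_add]
  have hg' : u⁻¹ * g ≠ 0 := by
    intro h
    apply hg; have := congrArg (u * ·) h; simpa [← mul_assoc, ZMod.mul_inv_of_unit u hu] using this
  have hneg : (u⁻¹ * -g).val = m - (u⁻¹ * g).val := by
    rw [mul_neg, ZMod.neg_val, if_neg hg']
  have hlt := ZMod.val_lt (u⁻¹ * g)
  have hpos : 0 < (u⁻¹ * g).val := Nat.pos_of_ne_zero (by rw [Ne, ZMod.val_eq_zero]; exact hg')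
  rw [hneg]
  split_ifs <;> omega

end ZModBookkeeping

section NecessityZMod

variable {m : ℕ} [NeZero m]

/-- The representatives of a list of residues sum, mod `m`, to the sum of the list. [folklore] -/
theorem natCast_sum_map_val_list (l : List (ZMod m)) : (((l.map ZMod.val).sum : ℕ) : ZMod m) = l.sum := by
  induction l with
  | nil => simp
  | cons a t ih => simp [ih]

/-- **NECESSITY at the unit `1`.** A compact ordering (all proper prefix sums non-zero) of non-zero residues summing
to `0` satisfies `m·#{letters = 1} + Σ val(letters) ≤ m(N+1)`, i.e. `#1 + W ≤ N + 1` with `W = Σ val / m` the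
winding number: the walk must jump over `W - 1` multiples of `m`, each time with a letter `≠ 1`. [folklore] -/
theorem compactOrdering_budget_one_le (l : List (ZMod m)) (h0 : ∀ x ∈ l, x ≠ 0) (hs : l.sum = 0)
    (hc : ∀ k, 0 < k → k < l.length → (l.take k).sum ≠ 0) :
    m * l.count 1 + (l.map ZMod.val).sum ≤ m * (l.length + 1) := by
  have hmpos : 0 < m := Nat.pos_of_ne_zero (NeZero.ne m)
  set v := l.map ZMod.val with hv
  have h1 : ∀ x ∈ v, 1 ≤ x := by
    intro x hx
    obtain ⟨y, hy, rfl⟩ := List.mem_map.mp hx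
    exact Nat.one_le_iff_ne_zero.mpr fun h => h0 y hy ((ZMod.val_eq_zero y).mp h)
  have hm : ∀ x ∈ v, x + 1 ≤ m := by
    intro x hx
    obtain ⟨y, _, rfl⟩ := List.mem_map.mp hx
    exact ZMod.val_lt y
  have hw : ∀ k, 0 < k → k < v.length → ¬ m ∣ (v.take k).sum := by
    intro k hk hkl hdvd
    rw [hv, List.length_map] at hkl
    apply hc k hk hkl
    rw [← natCast_sum_map_val_list, List.map_take, ZMod.natCast_eq_zero_iff]
    exact hdvd
  have key := count_one_add_walls_le_length m v h1 hm hw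
  -- `count 1 v = count 1 l`
  have hcount : v.count 1 = l.count 1 := by
    apply count_map_eq_count
    intro x hx
    haveI : Fact (1 < m) := ⟨one_lt_of_ne_zero (h0 x hx)⟩
    constructor
    · intro h; apply ZMod.val_injective m; rw [h, ZMod.val_one]
    · intro h; rw [h, ZMod.val_one]
  have hlen : v.length = l.length := List.length_map _
  rw [hcount, hlen] at key
  -- `m ∣ v.sum`
  have hdvd : m ∣ v.sum := by rw [← ZMod.natCast_eq_zero_iff, hv, natCast_sum_map_val_list, hs]
  obtain ⟨W, hW⟩ := hdvd
  rw [hW] at key ⊢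
  rcases Nat.eq_zero_or_pos W with hW0 | hWpos
  · subst hW0
    have := List.count_le_length (a := (1 : ZMod m)) (l := l)
    nlinarith
  · have e : (m * W - 1) / m = W - 1 := by
      obtain ⟨W', rfl⟩ : ∃ W', W = W' + 1 := ⟨W - 1, by omega⟩
      rw [Nat.mul_add, mul_one, Nat.add_sub_cancel, show m * W' + m - 1 = m * W' + (m - 1) by omega,
        Nat.mul_add_div hmpos, Nat.div_eq_of_lt (by omega)]
      omega
    rw [e] at key
    have : l.count 1 + W ≤ l.length + 1 := by omega
    nlinarith

/-- **NECESSITY (every unit).** If a list of non-zero residues summing to `0` is compactly ordered, then for every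
unit `u`: `m·#{letters = u} + Σᵢ val(u⁻¹·letterᵢ) ≤ m·(N + 1)` (scale by `u⁻¹` and apply the case `u = 1`).
[folklore] -/
theorem compactOrdering_budget_le (l : List (ZMod m)) (h0 : ∀ x ∈ l, x ≠ 0) (hs : l.sum = 0)
    (hc : ∀ k, 0 < k → k < l.length → (l.take k).sum ≠ 0) (u : ZMod m) (hu : IsUnit u) :
    m * l.count u + (l.map fun x => (u⁻¹ * x).val).sum ≤ m * (l.length + 1) := by
  set l' := l.map (fun x => u⁻¹ * x) with hl'
  have hinj : ∀ x : ZMod m, u⁻¹ * x = 0 → x = 0 := by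
    intro x h
    have := congrArg (u * ·) h
    simpa [← mul_assoc, ZMod.mul_inv_of_unit u hu] using this
  have h0' : ∀ x ∈ l', x ≠ 0 := by
    intro x hx
    obtain ⟨y, hy, rfl⟩ := List.mem_map.mp hx
    exact fun h => h0 y hy (hinj y h)
  have hs' : l'.sum = 0 := by rw [hl', List.sum_map_mul_left, List.map_id', hs, mul_zero]
  have hc' : ∀ k, 0 < k → k < l'.length → (l'.take k).sum ≠ 0 := by
    intro k hk hkl h
    rw [hl', List.length_map] at hkl
    rw [hl', ← List.map_take, List.sum_map_mul_left, List.map_id'] at h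
    exact hc k hk hkl (hinj _ h)
  have key := compactOrdering_budget_one_le l' h0' hs' hc'
  have hcount : l'.count 1 = l.count u := by
    apply count_map_eq_count
    intro x _
    constructor
    · intro h
      have := congrArg (u * ·) h
      simpa [← mul_assoc, ZMod.mul_inv_of_unit u hu] using this
    · intro h; rw [h, ZMod.inv_mul_of_unit u hu]
  rw [hcount, hl', List.length_map, List.map_map] at key
  exact key

end NecessityZMod

end Summit.HodgeConjecture.HodgeConjecture.WeilTypeLadder
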